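import Summits.PneNP.PneNP.Theorems.ChebyshevTracialDesignSmallBlockMaskPricingHH
import Summits.PneNP.PneNP.Theorems.ChebyshevTracialDesignSmallBlockMaskAverage
import Literature.Combinatorics.Optimization.ShellLawHalfPinningTwo
import HarnessLib

/-!
# Cell pnp-psdrank, route `ChebyshevTracialDesign`: TILTED SMALL BLOCKS — tools (brick 151a; crux `TracialDecayExp20`,
# stmt-PneNP-19878)

Brick 151a (prover g30; eng MEMO-26 §4, prover MEMO-32 §8 (iii-a), MEMO-33 §1). The tilted small-block line prices, PER
MATCHING and with EFFECTIVE constants, the (CG_1′) containment form `Σ_U W(U,M)·ψ(|U∩H|)·(Σ_p u_p x_p x_{πp})²` of a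
one-block mask on a SMALL block `H` in every TYPE-CONSTANT direction `u` (brick 148: with the `r = 1` excess this is every
direction). After the `HH`-class split (eng (K0)/(T-K3)) every class lives on a `π`-stable REDUCED ground set `S` on which
`H` has NO internal edge, the level weight is a POLYNOMIAL in the level, the reduced cut has EITHER parity, and the form is a
CROSSING-PLANE form `ψ(X)·(2λ(X − Y) + L − κc)²` (`X = |U∩H|`, `Y = |half U ∩ H|`, `c` the ORIGINAL level; lit's
`crossingWeight_containment_eq`). This file supplies the generic pieces of the per-class pricing (brick 151):

* §1 `tilted_pointwise_expansion` — the seven-term expansion of `ψ(X)(2λ(X−Y)+L−κc)²` (brick 120a with a free constant `L`).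
* §2 ground-set bookkeeping: sub-ground-sets of a block without internal edges have none and at most as many crossing edges
  (`reps_vAA_card_eq_zero_of_subset`, `reps_vB_card_le_of_subset`); `shellIn_nonempty_of_add_le` (shell sizes, lit (K1)).
* §3 the half-count and half-pair shell averages in ALL-LEVEL form (`avg_halfCount_eq`, `avg_halfPairs_eq`: lit's
  `shellInAvg_halfCount_blockStat_eq` / `shellInAvg_halfPairs_blockStat_eq`, extended by the trivial levels `c' ≤ 0`, `c' ≤ 1`).
* §4 **`piece_abs_le`** — a polynomially weighted, base-shifted, level-shifted shell profile of a bounded mask on a block without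
  internal edges (any stable ground set, either parity) is PURE REMAINDER when its weight vanishes at the virtual level:
  `|Σ_c w_c p(c)·E_{Shell_S(2s₀+c₀, c−g)}[ψ(|U∩H|)]| ≤ B_v·P·C((T−1)/2, D′+1)·G·q_b^{D′+1}` (`q_b = ¼(b/R)²e^{3b/R}`;
  `ExactDesignWeightedRemainder.abs_levelSum_mul_le_of_eval_zero` fed by `ShellLawSmallBlockSmoothness.abs_fwdDiff_iter_one_shellInAvg_le`);
  **`piece_main_le`** — the same one-sidedly for the MAIN piece (`g = 0`, odd cut, `p(0) ≥ 0`, `ψ ≥ 0`), the virtual value being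
  `≥ 0` by T-K4b §2 `classProfile_virtual_nonneg`.
WHAT THIS FILE DOES NOT DO: the assembly (brick 151), the class split on `[n]` (152), the `M`-average (153); anything on
`TracialDecayExp20` itself, psd rank of P_PM(K_n), or P vs NP. [cite: Rothvoss2017, §2 (PDF p. 6)]
[cite: Agarwal2000DifferenceEquations, Remark 1.8.1 (1.8.8)] [cite: RollinRoss2010, §3 (Lemma 3.1)]
Stature: support/instrument (kernel lane, no defs, axioms standard). Supports stmt-PneNP-19878.
-/

set_option linter.dupNamespace false -- `Summit.PneNP.PneNP.…`: summit = sub-problem (D-0017)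

noncomputable section

namespace Summit.PneNP.PneNP.Theorems.ChebyshevTracialDesignTiltedSmallBlockTools

open Finset Polynomial Literature.Barriers.PneNP Literature.Combinatorics.Optimization
open Literature.Combinatorics.Optimization.ShellStep
open Summit.PneNP.PneNP.Theorems.ChebyshevTracialDesignSmallBlockMaskPricingHH (classProfile_virtual_nonneg)
open Summit.PneNP.PneNP.Theorems.ChebyshevTracialDesignSmallBlockMaskAverage (qParam_mono)

variable {n : ℕ}

/-! ### §1 The seven-term expansion with a free constant -/

/-- **The tilted crossing-plane form, expanded**: with `ψ₁ = ψ·(2λX+L)`, `ψ₀ = ψ·(2λX+L)²`,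
`ψ·(2λ(X−Y) + L − κc)² = ψ₀ − 2κc·ψ₁ + κ²c²·ψ − 4λ·Yψ₁ + 4λκc·Yψ + 4λ²·Yψ + 4λ²·Y(Y−1)ψ`.
[cite: Rothvoss2017, §2 (PDF p. 6)] -/
theorem tilted_pointwise_expansion (ψv X Y c L lam kap : ℝ) :
    ψv * (2 * lam * (X - Y) + L - kap * c) ^ 2 =
      ψv * (2 * lam * X + L) ^ 2 - 2 * kap * c * (ψv * (2 * lam * X + L)) + kap ^ 2 * c ^ 2 * ψv
        - 4 * lam * (Y * (ψv * (2 * lam * X + L))) + 4 * lam * kap * c * (Y * ψv) + 4 * lam ^ 2 * (Y * ψv)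
        + 4 * lam ^ 2 * (Y * (Y - 1) * ψv) := by
  ring

/-! ### §2 Ground-set bookkeeping -/

section Ground

variable {π : Fin n → Fin n} (hπ : ∀ v, π (π v) = v) (hπ' : ∀ v, π v ≠ v)

omit hπ hπ' in
/-- `reps` is monotone. [cite: GodsilMeagher2015, §15.2] -/
theorem reps_mono {A B : Finset (Fin n)} (h : A ⊆ B) : reps π A ⊆ reps π B := by
  intro v hv
  rw [mem_reps] at hv ⊢
  exact ⟨h hv.1, hv.2⟩

omit hπ hπ' in
/-- A sub-ground-set of a block without internal edges has none. [cite: Rothvoss2017, §2 (PDF p. 5)] -/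
theorem reps_vAA_card_eq_zero_of_subset {S S' : Finset (Fin n)} (hS' : S' ⊆ S) (H : Finset (Fin n))
    (h0 : (reps π (vAA π S H)).card = 0) : (reps π (vAA π S' H)).card = 0 := by
  rw [card_eq_zero] at h0 ⊢
  refine subset_empty.1 (h0 ▸ reps_mono fun v hv => ?_)
  rw [mem_vAA] at hv ⊢
  exact ⟨hS' hv.1, hv.2⟩

omit hπ hπ' in
/-- A sub-ground-set meets at most as many crossing edges of the block. [cite: Rothvoss2017, §2 (PDF p. 5)] -/
theorem reps_vB_card_le_of_subset {S S' : Finset (Fin n)} (hS' : S' ⊆ S) (H : Finset (Fin n)) :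
    (reps π (vBH π S' H ∪ vBN π S' H)).card ≤ (reps π (vBH π S H ∪ vBN π S H)).card := by
  refine card_le_card (reps_mono fun v hv => ?_)
  rw [mem_union, mem_vBH, mem_vBN] at hv ⊢
  rcases hv with h | h
  · exact Or.inl ⟨hS' h.1, h.2⟩
  · exact Or.inr ⟨hS' h.1, h.2⟩

include hπ hπ' in
/-- Shells of a stable ground set with `N` edges are nonempty as long as `s + c ≤ N` (`t = 2s + c`).
[cite: Rothvoss2017, §2 (PDF p. 6)] -/
theorem shellIn_nonempty_of_add_le {S : Finset (Fin n)} (hS : ∀ v ∈ S, π v ∈ S) {N : ℕ} (hN : S.card = 2 * N)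
    {s c : ℕ} (hsc : s + c ≤ N) : (shellIn π S (2 * s + c) c).Nonempty := by
  rw [← card_pos, card_shellIn_eq_choose hπ hπ' hS hN s c]
  have h1 : 0 < N.choose s := Nat.choose_pos (by omega)
  have h2 : 0 < (N - s).choose c := Nat.choose_pos (by omega)
  positivity

omit hπ hπ' in
/-- In a stable ground set without `HH` edge, a vertex of `S ∩ H` has its partner in `S ∖ H`: `|S ∩ H| + 1 ≤ |S|`.
[cite: Rothvoss2017, §2 (PDF p. 5)] -/
theorem card_inter_succ_le {S : Finset (Fin n)} (hS : ∀ v ∈ S, π v ∈ S) (H : Finset (Fin n))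
    (hno : ∀ v ∈ S, ¬ (v ∈ H ∧ π v ∈ H)) {v : Fin n} (hv : v ∈ S ∩ H) : (S ∩ H).card + 1 ≤ S.card := by
  have hvS : v ∈ S := (mem_inter.1 hv).1
  have hvH : v ∈ H := (mem_inter.1 hv).2
  have hπv : π v ∈ S \ (S ∩ H) := by
    rw [mem_sdiff, mem_inter]
    exact ⟨hS v hvS, fun h => hno v hvS ⟨hvH, h.2⟩⟩
  have h1 : (S ∩ H).card + (S \ (S ∩ H)).card = S.card := by
    rw [card_sdiff_of_subset inter_subset_left]; have := card_le_card (inter_subset_left (s₁ := S) (s₂ := H)); omega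
  have h2 : 1 ≤ (S \ (S ∩ H)).card := card_pos.2 ⟨_, hπv⟩
  omega

end Ground

/-! ### §3 Half-count and half-pair averages at every level -/

section HalfAvg

variable {π : Fin n → Fin n} (hπ : ∀ v, π (π v) = v) (hπ' : ∀ v, π v ≠ v)
include hπ hπ'

/-- **The half-count average, all levels**: for a stable `S`, `t' ≥ 1`, and every level `c'` (the shell being nonempty
when `c' ≥ 1`): `E_{Shell_S(t',c')}[Y·ψ(X)] = (c'/|S|)·Σ_{v∈S∩H} E_{Shell_{S∖e_v}(t'−1,c'−1)}[ψ(X+1)]`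
(`X = |U∩H|`, `Y = |half U ∩ H|`; at `c' = 0` both sides vanish). [cite: Rothvoss2017, §2 (PDF p. 6)] -/
theorem avg_halfCount_eq {S : Finset (Fin n)} (hS : ∀ u ∈ S, π u ∈ S) (H : Finset (Fin n)) {t' : ℕ} (ht' : 1 ≤ t')
    (c' : ℕ) (ψ : ℤ → ℝ) (hne : 1 ≤ c' → (shellIn π S t' c').Nonempty) :
    (∑ U ∈ shellIn π S t' c', ((half π U ∩ H).card : ℝ) * ψ ((U ∩ H).card : ℤ)) / ((shellIn π S t' c').card : ℝ) =
      ((c' : ℝ) / (S.card : ℝ)) * ∑ v ∈ S ∩ H,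
        (∑ W ∈ shellIn π (S \ {v, π v}) (t' - 1) (c' - 1), ψ (((W ∩ H).card : ℤ) + 1)) /
          ((shellIn π (S \ {v, π v}) (t' - 1) (c' - 1)).card : ℝ) := by
  rcases Nat.eq_zero_or_pos c' with rfl | hc
  · -- level `0`: no half vertex
    have h0 : ∀ U ∈ shellIn π S t' 0, ((half π U ∩ H).card : ℝ) * ψ ((U ∩ H).card : ℤ) = 0 := by
      intro U hU
      have h := (mem_shellIn.1 hU).2.2
      rw [card_eq_zero] at h
      rw [h, empty_inter, card_empty, Nat.cast_zero, zero_mul]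
    rw [sum_congr rfl h0, sum_const_zero, zero_div, Nat.cast_zero, zero_div, zero_mul]
  · obtain ⟨t, rfl⟩ : ∃ t, t' = t + 1 := ⟨t' - 1, by omega⟩
    obtain ⟨c, rfl⟩ : ∃ c, c' = c + 1 := ⟨c' - 1, by omega⟩
    rw [shellInAvg_halfCount_blockStat_eq hπ hπ' hS H t c ψ (hne hc), Nat.add_sub_cancel, Nat.add_sub_cancel]
    push_cast
    ring

/-- **The half-pair average, all levels**: for a stable `S`, `t' ≥ 2`, and every level `c'` (the shell being nonempty when
`c' ≥ 2`): `E_{Shell_S(t',c')}[Y(Y−1)·ψ(X)] = (c'(c'−1)/(|S|(|S|−2)))·Σ_{v∈S∩H} Σ_{w∈(S∩H)∖e_v} E_{Shell_{S∖e_v∖e_w}(t'−2,c'−2)}[ψ(X+2)]`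
(at `c' ≤ 1` both sides vanish). [cite: Rothvoss2017, §2 (PDF p. 6)] -/
theorem avg_halfPairs_eq {S : Finset (Fin n)} (hS : ∀ u ∈ S, π u ∈ S) (H : Finset (Fin n)) {t' : ℕ} (ht' : 2 ≤ t')
    (c' : ℕ) (ψ : ℤ → ℝ) (hne : 2 ≤ c' → (shellIn π S t' c').Nonempty) :
    (∑ U ∈ shellIn π S t' c', ((half π U ∩ H).card : ℝ) * (((half π U ∩ H).card : ℝ) - 1) * ψ ((U ∩ H).card : ℤ)) /
        ((shellIn π S t' c').card : ℝ) =
      (((c' : ℝ) * ((c' : ℝ) - 1)) / ((S.card : ℝ) * ((S.card : ℝ) - 2))) * ∑ v ∈ S ∩ H, ∑ w ∈ (S ∩ H) \ {v, π v},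
        (∑ W ∈ shellIn π (del2 π S v w) (t' - 2) (c' - 2), ψ (((W ∩ H).card : ℤ) + 2)) /
          ((shellIn π (del2 π S v w) (t' - 2) (c' - 2)).card : ℝ) := by
  rcases lt_or_ge c' 2 with hc | hc
  · -- levels `0, 1`: at most one half vertex, `Y(Y−1) = 0`
    have h0 : ∀ U ∈ shellIn π S t' c',
        ((half π U ∩ H).card : ℝ) * (((half π U ∩ H).card : ℝ) - 1) * ψ ((U ∩ H).card : ℤ) = 0 := by
      intro U hU
      have h := (mem_shellIn.1 hU).2.2
      have hY : (half π U ∩ H).card ≤ 1 := (card_le_card inter_subset_left).trans (by omega)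
      interval_cases hY' : (half π U ∩ H).card <;> simp
    rw [sum_congr rfl h0, sum_const_zero, zero_div]
    have hz : (c' : ℝ) * ((c' : ℝ) - 1) = 0 := by
      interval_cases c' <;> simp
    rw [hz, zero_div, zero_mul]
  · obtain ⟨t, rfl⟩ : ∃ t, t' = t + 2 := ⟨t' - 2, by omega⟩
    obtain ⟨c, rfl⟩ : ∃ c, c' = c + 2 := ⟨c' - 2, by omega⟩
    rw [shellInAvg_halfPairs_blockStat_eq hπ hπ' hS H t c ψ (hne hc), Nat.add_sub_cancel, Nat.add_sub_cancel]
    push_cast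
    ring

end HalfAvg

/-! ### §4 Pricing one piece: vanishing virtual weight (pure remainder) and the main piece -/

section Piece

variable {π : Fin n → Fin n} (hπ : ∀ v, π (π v) = v) (hπ' : ∀ v, π v ≠ v)
include hπ hπ'

/-- **A piece with vanishing virtual weight is pure remainder.** Exact design `(n,t,T,D,B_v,C,w)` (only its rule is used);
a stable ground set `S` with `N'` edges, a block `H` with no edge of `S` inside and `b' ≤ b` crossing edges; the reduced cut
`2s₀ + c₀`, a level shift `g` and a base `i₀` with `2i₀ + 1 = g + c₀` (so the reduced levels `c − g`, `c = 2(j+i₀)+1`, are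
`c₀ + 2j`); `R ≥ 1`, `R + 3(D′+1) + b + (T−1)/2 ≤ s₀ + 1`, `R + 3(D′+1) + b + s₀ + (T−1)/2 + c₀ ≤ N'`; a mask `|ψ| ≤ G` on
`[0, 2s₀+c₀]`; a polynomial weight `p` with `deg p + D′ ≤ D`, `p(0) = 0`, vanishing on the levels `< 2i₀+1`, `|p| ≤ P` on
the levels. Then `|Σ_c w_c p(c)·E_{Shell_S(2s₀+c₀, c−g)}[ψ(|U∩H|)]| ≤ B_v·P·C((T−1)/2, D′+1)·G·(¼(b/R)²e^{3b/R})^{D′+1}`.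
[cite: Agarwal2000DifferenceEquations, Remark 1.8.1 (1.8.8)] [cite: RollinRoss2010, §3 (Lemma 3.1)] -/
theorem piece_abs_le {t T D : ℕ} {Bv : ℝ} {C : Finset ℕ} {w : ℕ → ℝ} (hdes : IsExactDesign n t T D Bv C w)
    {S : Finset (Fin n)} (hS : ∀ v ∈ S, π v ∈ S) {N' : ℕ} (hN : S.card = 2 * N')
    (H : Finset (Fin n)) (h0 : (reps π (vAA π S H)).card = 0)
    {b b' : ℕ} (hb' : (reps π (vBH π S H ∪ vBN π S H)).card = b') (hb'b : b' ≤ b)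
    {s₀ c₀ i₀ g D' R : ℕ} (hc₀ : 2 * i₀ + 1 = g + c₀) (hR : 1 ≤ R)
    (hR1 : R + 3 * (D' + 1) + b + (T - 1) / 2 ≤ s₀ + 1)
    (hR2 : R + 3 * (D' + 1) + b + s₀ + (T - 1) / 2 + c₀ ≤ N')
    (ψ : ℤ → ℝ) {G : ℝ} (hG : ∀ x ∈ Icc (0 : ℤ) ((2 * s₀ + c₀ : ℕ) : ℤ), |ψ x| ≤ G)
    (p : ℝ[X]) (hdeg : p.natDegree + D' ≤ D) (hpz : p.eval 0 = 0)
    (hp0 : ∀ c ∈ C, c < 2 * i₀ + 1 → p.eval (c : ℝ) = 0) {P : ℝ} (hP : ∀ c ∈ C, |p.eval (c : ℝ)| ≤ P) :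
    |∑ c ∈ C, w c * (p.eval (c : ℝ) *
        ((∑ U ∈ shellIn π S (2 * s₀ + c₀) (c - g), ψ ((U ∩ H).card : ℤ)) /
          ((shellIn π S (2 * s₀ + c₀) (c - g)).card : ℝ)))| ≤
      Bv * P * ((((T - 1) / 2).choose (D' + 1) : ℕ) : ℝ) *
        (G * ((1 / 4 : ℝ) * ((b : ℝ) / R) ^ 2 * Real.exp (3 * b / R)) ^ (D' + 1)) := by
  have hG0 : 0 ≤ G := (abs_nonneg _).trans (hG 0 (mem_Icc.2 ⟨le_rfl, by positivity⟩))
  set Φ : ℕ → ℝ := fun c => (∑ U ∈ shellIn π S (2 * s₀ + c₀) (c - g), ψ ((U ∩ H).card : ℤ)) /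
    ((shellIn π S (2 * s₀ + c₀) (c - g)).card : ℝ) with hΦ
  set q : ℝ := (1 / 4 : ℝ) * ((b : ℝ) / R) ^ 2 * Real.exp (3 * b / R) with hqdef
  set q' : ℝ := (1 / 4 : ℝ) * ((b' : ℝ) / R) ^ 2 * Real.exp (3 * b' / R) with hq'def
  have hq'0 : 0 ≤ q' := by rw [hq'def]; positivity
  have hq'q : q' ≤ q := qParam_mono hb'b
  have hK : ∀ j : ℕ, 2 * (j + i₀ + D' + 1) + 1 ≤ T →
      |((fwdDiff (1 : ℕ))^[D' + 1] (fun j => Φ (2 * (j + i₀) + 1))) j| ≤ G * q ^ (D' + 1) := by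
    intro j hj
    have hfun : (fun j' => Φ (2 * (j' + i₀) + 1)) = fun j' =>
        (∑ U ∈ shellIn π S (2 * s₀ + c₀) (c₀ + 2 * j'), ψ ((U ∩ H).card : ℤ)) /
          ((shellIn π S (2 * s₀ + c₀) (c₀ + 2 * j')).card : ℝ) := by
      funext j'
      rw [hΦ]
      simp only
      rw [show 2 * (j' + i₀) + 1 - g = c₀ + 2 * j' by omega]
    rw [hfun]
    refine (abs_fwdDiff_iter_one_shellInAvg_le hπ hπ' hS hN H h0 hb' hR (by omega) (by omega) ψ hG).trans ?_
    rw [← hq'def]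
    exact mul_le_mul_of_nonneg_left (pow_le_pow_left₀ hq'0 hq'q _) hG0
  exact hdes.abs_levelSum_mul_le_of_eval_zero p hdeg hpz hp0 hP Φ (by positivity) hK

/-- **The main piece** (`g = 0`, odd reduced cut `2s₀+1`, virtual weight `p(0) ≥ 0`, mask `0 ≤ ψ ≤ G`): one-sidedly
`Σ_c w_c p(c)·E_{Shell_S(2s₀+1, c)}[ψ(|U∩H|)] ≤ B_v·P·C((T−1)/2, D′+1)·G·(¼(b/R)²e^{3b/R})^{D′+1}`, the exactly priced main
term `−p(0)·N^{odd}_{D′}φ(0)` being `≤ 0` (T-K4b §2 `classProfile_virtual_nonneg`); needs `(b/R)²e^{3b/R} ≤ 2`.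
[cite: Agarwal2000DifferenceEquations, Remark 1.8.1 (1.8.8)] [cite: RollinRoss2010, §3 (Lemma 3.1)] -/
theorem piece_main_le {t T D : ℕ} {Bv : ℝ} {C : Finset ℕ} {w : ℕ → ℝ} (hdes : IsExactDesign n t T D Bv C w)
    {S : Finset (Fin n)} (hS : ∀ v ∈ S, π v ∈ S) {N' : ℕ} (hN : S.card = 2 * N')
    (H : Finset (Fin n)) (h0 : (reps π (vAA π S H)).card = 0)
    {b b' : ℕ} (hb' : (reps π (vBH π S H ∪ vBN π S H)).card = b') (hb'b : b' ≤ b)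
    {s₀ D' R : ℕ} (hR : 1 ≤ R)
    (hR1 : R + 3 * (D' + 1) + b + (T - 1) / 2 ≤ s₀ + 1)
    (hR2 : R + 3 * (D' + 1) + b + s₀ + (T - 1) / 2 + 1 ≤ N')
    (hq : ((b : ℝ) / R) ^ 2 * Real.exp (3 * b / R) ≤ 2)
    (ψ : ℤ → ℝ) {G : ℝ} (hG : ∀ x ∈ Icc (0 : ℤ) ((2 * s₀ + 1 : ℕ) : ℤ), |ψ x| ≤ G)
    (hψ0 : ∀ x ∈ Icc (0 : ℤ) ((2 * s₀ + 1 : ℕ) : ℤ), 0 ≤ ψ x)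
    (p : ℝ[X]) (hdeg : p.natDegree + D' ≤ D) (hp0 : 0 ≤ p.eval 0) {P : ℝ} (hP : ∀ c ∈ C, |p.eval (c : ℝ)| ≤ P) :
    ∑ c ∈ C, w c * (p.eval (c : ℝ) *
        ((∑ U ∈ shellIn π S (2 * s₀ + 1) c, ψ ((U ∩ H).card : ℤ)) / ((shellIn π S (2 * s₀ + 1) c).card : ℝ))) ≤
      Bv * P * ((((T - 1) / 2).choose (D' + 1) : ℕ) : ℝ) *
        (G * ((1 / 4 : ℝ) * ((b : ℝ) / R) ^ 2 * Real.exp (3 * b / R)) ^ (D' + 1)) := by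
  have hG0 : 0 ≤ G := (abs_nonneg _).trans (hG 0 (mem_Icc.2 ⟨le_rfl, by positivity⟩))
  set Φ : ℕ → ℝ := fun c => (∑ U ∈ shellIn π S (2 * s₀ + 1) c, ψ ((U ∩ H).card : ℤ)) /
    ((shellIn π S (2 * s₀ + 1) c).card : ℝ) with hΦ
  set q : ℝ := (1 / 4 : ℝ) * ((b : ℝ) / R) ^ 2 * Real.exp (3 * b / R) with hqdef
  set q' : ℝ := (1 / 4 : ℝ) * ((b' : ℝ) / R) ^ 2 * Real.exp (3 * b' / R) with hq'def
  have hq'0 : 0 ≤ q' := by rw [hq'def]; positivity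
  have hq'q : q' ≤ q := qParam_mono hb'b
  have hq' : ((b' : ℝ) / R) ^ 2 * Real.exp (3 * b' / R) ≤ 2 := by
    have h4 : (4 : ℝ) * q' ≤ 4 * q := by linarith
    have e1 : (4 : ℝ) * q' = ((b' : ℝ) / R) ^ 2 * Real.exp (3 * b' / R) := by rw [hq'def]; ring
    have e2 : (4 : ℝ) * q = ((b : ℝ) / R) ^ 2 * Real.exp (3 * b / R) := by rw [hqdef]; ring
    linarith
  have hK : ∀ j : ℕ, 2 * (j + D' + 1) + 1 ≤ T →
      |((fwdDiff (1 : ℕ))^[D' + 1] (fun j => Φ (2 * j + 1))) j| ≤ G * q ^ (D' + 1) := by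
    intro j hj
    have hfun : (fun j' => Φ (2 * j' + 1)) = fun j' =>
        (∑ U ∈ shellIn π S (2 * s₀ + 1) (1 + 2 * j'), ψ ((U ∩ H).card : ℤ)) /
          ((shellIn π S (2 * s₀ + 1) (1 + 2 * j')).card : ℝ) := by
      funext j'; rw [hΦ, Nat.add_comm 1 (2 * j')]
    rw [hfun]
    refine (abs_fwdDiff_iter_one_shellInAvg_le hπ hπ' hS hN H h0 hb' hR (by omega) (by omega) ψ hG).trans ?_
    rw [← hq'def]
    exact mul_le_mul_of_nonneg_left (pow_le_pow_left₀ hq'0 hq'q _) hG0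
  -- the main term: `p(0)·N_{D′}Φ(0) ≥ 0`
  have hmain : 0 ≤ p.eval 0 * (DesignRemainder.newtonPolyOdd D' Φ).eval 0 := by
    refine mul_nonneg hp0 ?_
    have hfun : Φ = fun c => ∑ x ∈ Icc (0 : ℤ) ((2 * s₀ + 1 : ℕ) : ℤ),
        ψ x * shellLaw π S H (2 * s₀ + 1) c (x - 0) := by
      funext c; rw [hΦ]; simp only [sub_zero]; exact shellInAvg_eq_sum_mul_shellLaw S H _ c ψ
    rw [hfun]
    exact classProfile_virtual_nonneg hπ hπ' hS hN H h0 hb' hR (by omega) (by omega) hq' _ 0 ψ hψ0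
      (fun x hx => (le_abs_self _).trans (hG x hx))
  exact hdes.levelSum_mul_le_of_fwdDiff_odd p hdeg hP Φ (by positivity) hK hmain

end Piece


end Summit.PneNP.PneNP.Theorems.ChebyshevTracialDesignTiltedSmallBlockTools

end
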